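import Literature.AnabelianGeometry.EtaleTheta.Discharge.Sec4Prop43iOfGaloisSurjNatural
import Literature.AnabelianGeometry.EtaleTheta.Discharge.Sec4Prop43iConnectedModel
import Literature.AnabelianGeometry.EtaleTheta.Discharge.Sec4Prop43iiHolds
import Literature.AnabelianGeometry.EtaleTheta.Discharge.Sec5OfConnectedTemperoid
import Literature.AlgebraicGeometry.Frobenioids.ModelFrobenioidAutDescent

/-!
# [EtTh] Prop 4.3 (i) AS TYPED from the outer naturality of Def. 4.1 (ii) ALONE — `Φ` divisorial removed;
# unconditional at the §4/§5 settings over the connected temperoid `B^temp(Π^tp_X)⁰`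

Mochizuki, *The étale theta function and its Frobenioid-theoretic manifestations*, Publ. RIMS **45**
(2009), §4, Prop. 4.3 (i) p.90 (PDF; printed p.316), proof p.91 [cite: MochizukiEtTh2009, Prop 4.3 (i)
p.90–91]: "there exist UNIQUE group homomorphisms `s'_N{}^{gp}, s''_N{}^{gp} : H_{B_N} → Aut_C(B_N)` …
[In particular, it follows that `B_N` is `H_⊙`-ample.] … it suffices [the first equivalence of categories
involving pre-steps of [FrdI] Def. 1.3 (iii)(d); total epimorphicity] to prove that `Div(s'_N)`, `Div(s''_N)`
are fixed by `H_{A_N}` … [`Φ(A_N)` torsion-free!]".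

abc-iut cell, block F (fact-proving wave), seat abc-iut-f-109 (FACT-LIST row F-0492
`BiKummerSetting.Prop43_i`; own-row follow-up, taking abc-iut-f-111's standing offer of 2026-08-26T08:46Z).
PROOF-ONLY companion (no definition, no named fact, no instance) of abc-iut-L2-t3's `BiKummerRoots.lean`.
The cell's discharge of the typed Prop. 4.3 (i) — abc-iut-L6-t12's `prop43_i_of'` (`Sec4Prop43i.lean`) and
this seat's `prop43_i_of_galoisSurjNatural` (`Sec4Prop43iOfGaloisSurjNatural.lean`, p428079) — still
carried the structural hypothesis `hΦd : Objectwise IsDivisorial S.tf.divisorMonoid` ("`Φ` divisorial",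
[FrdI] Thm. 5.2 (ii)), which over an ARBITRARY [FrdI] category vocabulary `VD : FrdICatStub D` is not
derivable (the Def. 3.6 (ii) clause "divisorial monoid on `D`" is the vocabulary field `VD.IsDivisorialOn`).
Here `hΦd` is shown to be UNNECESSARY.  It entered the printed proof at three places, each of which holds
in EVERY tempered Frobenioid:
* "`Φ(A_N)` is torsion-free" (`N · x = N · y ⇒ x = y`) — from the SETTING's own field "`Φ` perfect"
  (`BiKummerSetting.isPerfect`: multiplication by `N` is bijective), `NthRoot.pull_div_num_eq'`;
* "the first equivalence of categories involving pre-steps of [FrdI] Def. 1.3 (iii)(d)" — the descent of a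
  `τ ∈ Aut_C(A_N)` fixing `Div(s'_N)` along the base-isomorphism `s'_N` is WRITTEN DOWN in the model
  Frobenioid ([FrdI] Thm. 5.2 (i)): `σ := (1, b⁻¹ ∘ Base(τ) ∘ b, (b⁻¹)^* Div(τ), (b⁻¹)^*(Base(τ)^* u_{s} ·
  u_τ · u_s⁻¹))`, `b := Base(s'_N)` — valid although `Div(τ)` may be a NON-TRIVIAL unit of `Φ(A_N)` when
  `Φ` is not sharp (`ModelFrobenioid.exists_aut_comp_eq_of_pull_div_eq` of
  `Frobenioids/ModelFrobenioidAutDescent.lean`, this seat; the inverse exists by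
  `ModelFrobenioid.isIso_of_isUnit_div`: degree `1`, base-isomorphism, UNIT zero divisor ⇒ isomorphism),
  here `TemperedFrobenioid.existsUnique_aut_comp_eq_of_pull_div_eq`, `NthRoot.existsUnique_aut_comp_num'`;
* "Frobenioids are always totally epimorphic" (uniqueness) — abc-iut-f-111's
  `TemperedFrobenioid.aut_eq_of_comp_eq` (Def. 3.6 (ii)(a): `Φ^{bs-fld}` monoprime).
Consequences (FQ types):
* `BiKummerSetting.prop43_i_of''` — `Prop43_i` modulo ONLY the two printed base-level inputs `hα`, `hamp`;
* `BiKummerSetting.prop43_i_of_galoisSurjNatural'` / `prop43_i_holds_of_galoisSurjNatural` — **`Prop43_i`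
  for EVERY `S : BiKummerSetting X T D VD` and every transport `pullFrac`, from the owner-named outer
  naturality `GaloisSurjNatural` of Def. 4.1 (ii) ALONE**;
* `prop43_i_mkOfModelCanonical_connectedPart'`, `prop43_i_mkOfConnectedTemperoid`,
  `prop43_i_mkOfConnectedTemperoidQuot` — **`Prop43_i` with NO residual hypothesis at the canonical §4
  setting and at abc-iut-L2-t4's §5 settings over the GENUINE connected base `B^temp(Π^tp_X)⁰`, for a
  GENERAL vocabulary `VD`** (before: only at `treeCatVocab`, p429782).
HONEST FRAMING: [EtTh] is a published, refereed paper; a FACT-LIST row is an assumption label, and this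
file merely shrinks one; the universal closure over settings violating the naturality of Def. 4.1 (ii) is
not claimed; no side is taken on [IUTchIII] Cor. 3.12; typed ≠ proved for anything not proved here.
-/

noncomputable section

namespace Literature.AnabelianGeometry.EtaleTheta

open CategoryTheory Opposite Literature.AlgebraicGeometry.Frobenioids

universe u₀ v₀ u v w

/-! ### Tempered Frobenioids: the descent is unique (Def. 3.6 (ii)(a)) -/

namespace TemperedFrobenioid

variable {D₀ : Type u₀} [Category.{v₀} D₀] {V : FrdIMonoidStub.{w}}
  {T : RealifiedDivisorMonoids (D₀ := D₀) V} {D : Type u} [Category.{v} D]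
  {VD : FrdICatStub.{u, v, w} D} (C₀ : TemperedFrobenioid T D VD)

/-- **In EVERY tempered Frobenioid, an automorphism `τ` of `X` fixing `Div(s)` descends UNIQUELY along a
linear base-isomorphism `s : X → Y`**: there is exactly one `σ ∈ Aut_C(Y)` with `σ ∘ s = s ∘ τ`
(existence: `ModelFrobenioid.exists_aut_comp_eq_of_pull_div_eq`, `B` group-like by
`ratFnFunctor_isGroupLike_holds`; uniqueness: abc-iut-f-111's `aut_eq_of_comp_eq`) — the [FrdI] input of
the proof of Prop. 4.3 (i), p.91, with NO divisoriality of `Φ`. [cite: MochizukiEtTh2009, Prop 4.3 (i) p.91] -/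
theorem existsUnique_aut_comp_eq_of_pull_div_eq {X Y : C₀.category} (s : X ⟶ Y)
    [IsIso (ModelFrobenioid.baseMap s)] (hs : ModelFrobenioid.degFr s = 1) (τ : Aut X)
    (hτ : pull C₀.divisorMonoid (ModelFrobenioid.baseMap τ.hom) (ModelFrobenioid.div s) =
      ModelFrobenioid.div s) :
    ∃! σ : Aut Y, s ≫ σ.hom = τ.hom ≫ s := by
  obtain ⟨σ, hσ⟩ :=
    ModelFrobenioid.exists_aut_comp_eq_of_pull_div_eq C₀.ratFnFunctor_isGroupLike_holds s hs τ hτ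
  exact ⟨σ, hσ, fun σ' hσ' => C₀.aut_eq_of_comp_eq s (hσ'.trans hσ.symm)⟩

end TemperedFrobenioid

variable {K : Type u₀} [Field K]

namespace BiKummerSetting

section Abstract

variable {X : SemiGraphs.TemperedArithmeticGroup.{u₀} K} {D₀ : Type u₀} [Category.{v₀} D₀]
  {V : FrdIMonoidStub.{w}} {T : RealifiedDivisorMonoids (D₀ := D₀) V} {D : Type u} [Category.{v} D]
  {VD : FrdICatStub.{u, v, w} D} {S : BiKummerSetting X T D VD}

namespace NthRoot

variable {A B : S.C} {f : S.biratUnits A} {P : S.FractionPair f B} {N : ℕ+}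
  {pullFrac : ∀ {A A' : S.C} (_ : A' ⟶ A), S.biratUnits A → S.biratUnits A'}
  (R : S.NthRoot f P N pullFrac)

/-- **`Div(s'_N)` is fixed by `τ ∈ Aut_C(A_N)` as soon as `τ` fixes `α^* Div(s')`** — "together with the
fact the monoid `Φ(A_N)` is torsion-free" (p.91), here from the SETTING's field "`Φ` perfect"
(`BiKummerSetting.isPerfect`: `x ↦ N · x` is injective on `Φ(A_N)`), not from divisoriality; abc-iut-L6-t12's
`pull_div_num_eq` without `hΦd`. [cite: MochizukiEtTh2009, Prop 4.3(i) p.91] -/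
theorem pull_div_num_eq' (τ : Aut R.AN)
    (hτ : pull S.tf.divisorMonoid (ModelFrobenioid.baseMap τ.hom)
        (pull S.tf.divisorMonoid (ModelFrobenioid.baseMap R.α) (ModelFrobenioid.div P.num)) =
      pull S.tf.divisorMonoid (ModelFrobenioid.baseMap R.α) (ModelFrobenioid.div P.num)) :
    pull S.tf.divisorMonoid (ModelFrobenioid.baseMap τ.hom) (ModelFrobenioid.div R.pair.num) =
      ModelFrobenioid.div R.pair.num := by
  have hinj : ∀ {x y : S.tf.divisorMonoid.obj (op R.AN.base)}, x ^ (N : ℕ) = y ^ (N : ℕ) → x = y :=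
    fun h => ((S.isPerfect (op R.AN.base)).bijective_pow N N.pos).1 h
  apply hinj
  rw [← map_pow, R.div_num_pow, hτ]

/-- The same for the divisor of poles `Div(s''_N)`. [cite: MochizukiEtTh2009, Prop 4.3(i) p.91] -/
theorem pull_div_den_eq' (τ : Aut R.AN)
    (hτ : pull S.tf.divisorMonoid (ModelFrobenioid.baseMap τ.hom)
        (pull S.tf.divisorMonoid (ModelFrobenioid.baseMap R.α) (ModelFrobenioid.div P.den)) =
      pull S.tf.divisorMonoid (ModelFrobenioid.baseMap R.α) (ModelFrobenioid.div P.den)) :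
    pull S.tf.divisorMonoid (ModelFrobenioid.baseMap τ.hom) (ModelFrobenioid.div R.pair.den) =
      ModelFrobenioid.div R.pair.den := by
  have hinj : ∀ {x y : S.tf.divisorMonoid.obj (op R.AN.base)}, x ^ (N : ℕ) = y ^ (N : ℕ) → x = y :=
    fun h => ((S.isPerfect (op R.AN.base)).bijective_pow N N.pos).1 h
  apply hinj
  rw [← map_pow, R.div_den_pow, hτ]

/-- `Div(s'_N)` is fixed by any `τ ∈ Aut_C(A_N)` acting over `A^bs` trivially through `α`
(`Base(τ) · Base(α) = Base(α)`), in EVERY setting. [cite: MochizukiEtTh2009, Prop 4.3 (i) p.91] -/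
theorem pull_div_num_eq_of_base' (τ : Aut R.AN)
    (hτ : ModelFrobenioid.baseMap τ.hom ≫ ModelFrobenioid.baseMap R.α = ModelFrobenioid.baseMap R.α) :
    pull S.tf.divisorMonoid (ModelFrobenioid.baseMap τ.hom) (ModelFrobenioid.div R.pair.num) =
      ModelFrobenioid.div R.pair.num := by
  apply R.pull_div_num_eq' τ
  rw [← pull_comp, hτ]

/-- The same for `Div(s''_N)`. [cite: MochizukiEtTh2009, Prop 4.3 (i) p.91] -/
theorem pull_div_den_eq_of_base' (τ : Aut R.AN)
    (hτ : ModelFrobenioid.baseMap τ.hom ≫ ModelFrobenioid.baseMap R.α = ModelFrobenioid.baseMap R.α) :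
    pull S.tf.divisorMonoid (ModelFrobenioid.baseMap τ.hom) (ModelFrobenioid.div R.pair.den) =
      ModelFrobenioid.div R.pair.den := by
  apply R.pull_div_den_eq' τ
  rw [← pull_comp, hτ]

/-- **The lifting step of Prop. 4.3 (i) in EVERY setting**: an automorphism `τ` of `A_N` fixing `Div(s'_N)`
lifts UNIQUELY along `s'_N` (abc-iut-L6-t12's `existsUnique_aut_comp_num` without `Φ` divisorial / `B`
group-like). [cite: MochizukiEtTh2009, Prop 4.3(i) p.91] -/
theorem existsUnique_aut_comp_num' (τ : Aut R.AN)
    (hτ : pull S.tf.divisorMonoid (ModelFrobenioid.baseMap τ.hom) (ModelFrobenioid.div R.pair.num) =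
      ModelFrobenioid.div R.pair.num) :
    ∃! σ : Aut R.BN, R.pair.num ≫ σ.hom = τ.hom ≫ R.pair.num :=
  haveI : IsIso (ModelFrobenioid.baseMap R.pair.num) := R.pair.isPreStep_num.2
  S.tf.existsUnique_aut_comp_eq_of_pull_div_eq R.pair.num R.pair.isPreStep_num.1 τ hτ

/-- The lifting step of Prop. 4.3 (i) along the denominator pre-step `s''_N`, in EVERY setting.
[cite: MochizukiEtTh2009, Prop 4.3(i) p.91] -/
theorem existsUnique_aut_comp_den' (τ : Aut R.AN)
    (hτ : pull S.tf.divisorMonoid (ModelFrobenioid.baseMap τ.hom) (ModelFrobenioid.div R.pair.den) =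
      ModelFrobenioid.div R.pair.den) :
    ∃! σ : Aut R.BN, R.pair.den ≫ σ.hom = τ.hom ≫ R.pair.den :=
  haveI : IsIso (ModelFrobenioid.baseMap R.pair.den) := R.pair.isPreStep_den.2
  S.tf.existsUnique_aut_comp_eq_of_pull_div_eq R.pair.den R.pair.isPreStep_den.1 τ hτ

/-- **Prop. 4.3 (i), EXISTENCE, in EVERY setting** (p.90–91): given a trivializing section `s_N^triv` over
`H_{A_N}` and an identification `H_{A_N} ≅ H_{B_N}` lying over `Base(s'_N)`, if `H_{A_N}` acts over `A^bs`
trivially through `α` then there is a bi-Kummer `N`-th root with these `s^triv`, `ident` — abc-iut-L6-t12's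
`exists_biKummerRoot` with BOTH structural hypotheses removed. [cite: MochizukiEtTh2009, Prop 4.3 (i) p.90] -/
theorem exists_biKummerRoot' (hA : S.IsGalois R.AN) (hB : S.IsGalois R.BN)
    (striv : S.HA R.AN hA →* Aut R.AN)
    (hstriv : ∀ h : S.HA R.AN hA, S.autBase R.AN (striv h) = S.autBase R.AN (h : Aut R.AN))
    (ident : S.HA R.AN hA ≃* S.HA R.BN hB)
    (hident : ∀ h : S.HA R.AN hA,
      S.base.map R.pair.num ≫ S.base.map (ident h : Aut R.BN).hom =
        S.base.map (h : Aut R.AN).hom ≫ S.base.map R.pair.num)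
    (hα : ∀ h : S.HA R.AN hA,
      ModelFrobenioid.baseMap (striv h).hom ≫ ModelFrobenioid.baseMap R.α = ModelFrobenioid.baseMap R.α) :
    ∃ K : S.BiKummerRoot R hA hB, K.striv = striv ∧ K.ident = ident := by
  -- the unique descents along `s'_N` and `s''_N`
  have hexN : ∀ h : S.HA R.BN hB, ∃! σ : Aut R.BN,
      R.pair.num ≫ σ.hom = (striv (ident.symm h)).hom ≫ R.pair.num := fun h =>
    R.existsUnique_aut_comp_num' _ (R.pull_div_num_eq_of_base' _ (hα _))
  have hexD : ∀ h : S.HA R.BN hB, ∃! σ : Aut R.BN,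
      R.pair.den ≫ σ.hom = (striv (ident.symm h)).hom ≫ R.pair.den := fun h =>
    R.existsUnique_aut_comp_den' _ (R.pull_div_den_eq_of_base' _ (hα _))
  choose σN hσN using fun h => (hexN h).exists
  choose σD hσD using fun h => (hexD h).exists
  -- they are homomorphisms (uniqueness of the descent)
  have hN1 : σN 1 = 1 := by
    refine ((hexN 1).unique (hσN 1) ?_).symm ▸ rfl
    rw [map_one, map_one]
    change R.pair.num ≫ 𝟙 _ = 𝟙 _ ≫ R.pair.num
    rw [Category.comp_id, Category.id_comp]
  have hD1 : σD 1 = 1 := by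
    refine ((hexD 1).unique (hσD 1) ?_).symm ▸ rfl
    rw [map_one, map_one]
    change R.pair.den ≫ 𝟙 _ = 𝟙 _ ≫ R.pair.den
    rw [Category.comp_id, Category.id_comp]
  have hNmul : ∀ a b, σN (a * b) = σN a * σN b := by
    intro a b
    refine (hexN (a * b)).unique (hσN (a * b)) ?_
    rw [map_mul, map_mul]
    change R.pair.num ≫ ((σN b).hom ≫ (σN a).hom) =
      ((striv (ident.symm b)).hom ≫ (striv (ident.symm a)).hom) ≫ R.pair.num
    rw [← Category.assoc, hσN b, Category.assoc, hσN a, Category.assoc]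
  have hDmul : ∀ a b, σD (a * b) = σD a * σD b := by
    intro a b
    refine (hexD (a * b)).unique (hσD (a * b)) ?_
    rw [map_mul, map_mul]
    change R.pair.den ≫ ((σD b).hom ≫ (σD a).hom) =
      ((striv (ident.symm b)).hom ≫ (striv (ident.symm a)).hom) ≫ R.pair.den
    rw [← Category.assoc, hσD b, Category.assoc, hσD a, Category.assoc]
  let sNum : S.HA R.BN hB →* Aut R.BN :=
    { toFun := σN, map_one' := hN1, map_mul' := hNmul }
  let sDen : S.HA R.BN hB →* Aut R.BN :=
    { toFun := σD, map_one' := hD1, map_mul' := hDmul }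
  refine ⟨{ striv := striv, autBase_striv := hstriv, ident := ident, autBase_ident := hident,
            sNum := sNum, sDen := sDen, comm_num := fun h => ?_, comm_den := fun h => ?_ }, rfl, rfl⟩
  · have e := hσN (ident h)
    rw [MulEquiv.symm_apply_apply] at e
    exact e
  · have e := hσD (ident h)
    rw [MulEquiv.symm_apply_apply] at e
    exact e

end NthRoot

namespace BiKummerRoot

variable {A B : S.C} {f : S.biratUnits A} {P : S.FractionPair f B} {N : ℕ+}
  {pullFrac : ∀ {A A' : S.C} (_ : A' ⟶ A), S.biratUnits A → S.biratUnits A'}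
  {R : S.NthRoot f P N pullFrac} {hA : S.IsGalois R.AN} {hB : S.IsGalois R.BN}
  (K : S.BiKummerRoot R hA hB)

/-- **Prop. 4.3 (i), uniqueness half, in EVERY setting** (p.90): two bi-Kummer root data on the same
`N`-th root with the same `s_N^triv` and the same identification `H_{A_N} ≅ H_{B_N}` have the same sections —
abc-iut-L6-t12's `sNum_sDen_unique` with `Φ` divisorial / `B` group-like removed (base-isomorphisms are
left-cancellable against automorphisms in every tempered Frobenioid, abc-iut-f-111's
`TemperedFrobenioid.aut_eq_of_comp_eq`). [cite: MochizukiEtTh2009, Prop 4.3(i) p.90] -/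
theorem sNum_sDen_unique' (K' : S.BiKummerRoot R hA hB) (hs : K'.striv = K.striv) (hi : K'.ident = K.ident) :
    K'.sNum = K.sNum ∧ K'.sDen = K.sDen := by
  haveI : IsIso (ModelFrobenioid.baseMap R.pair.num) := R.pair.isPreStep_num.2
  haveI : IsIso (ModelFrobenioid.baseMap R.pair.den) := R.pair.isPreStep_den.2
  refine ⟨MonoidHom.ext fun h => ?_, MonoidHom.ext fun h => ?_⟩
  · apply S.tf.aut_eq_of_comp_eq R.pair.num
    rw [K'.comm_num' h, K.comm_num' h, hs, hi]
  · apply S.tf.aut_eq_of_comp_eq R.pair.den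
    rw [K'.comm_den' h, K.comm_den' h, hs, hi]

end BiKummerRoot

namespace NthRoot

variable {A B : S.C} {f : S.biratUnits A} {P : S.FractionPair f B} {N : ℕ+}
  {pullFrac : ∀ {A A' : S.C} (_ : A' ⟶ A), S.biratUnits A → S.biratUnits A'}
  (R : S.NthRoot f P N pullFrac)

/-- **Prop. 4.3 (i), the `∃!` clause, in EVERY setting**: existence (`exists_biKummerRoot'`) together with
uniqueness (`BiKummerRoot.sNum_sDen_unique'`). [cite: MochizukiEtTh2009, Prop 4.3 (i) p.90] -/
theorem existsUnique_sections' (hA : S.IsGalois R.AN) (hB : S.IsGalois R.BN)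
    (striv : S.HA R.AN hA →* Aut R.AN)
    (hstriv : ∀ h : S.HA R.AN hA, S.autBase R.AN (striv h) = S.autBase R.AN (h : Aut R.AN))
    (ident : S.HA R.AN hA ≃* S.HA R.BN hB)
    (hident : ∀ h : S.HA R.AN hA,
      S.base.map R.pair.num ≫ S.base.map (ident h : Aut R.BN).hom =
        S.base.map (h : Aut R.AN).hom ≫ S.base.map R.pair.num)
    (hα : ∀ h : S.HA R.AN hA,
      ModelFrobenioid.baseMap (striv h).hom ≫ ModelFrobenioid.baseMap R.α = ModelFrobenioid.baseMap R.α) :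
    ∃! p : (S.HA R.BN hB →* Aut R.BN) × (S.HA R.BN hB →* Aut R.BN),
      ∃ K : S.BiKummerRoot R hA hB, K.striv = striv ∧ K.ident = ident ∧ K.sNum = p.1 ∧ K.sDen = p.2 := by
  obtain ⟨K, hKs, hKi⟩ := R.exists_biKummerRoot' hA hB striv hstriv ident hident hα
  refine ⟨(K.sNum, K.sDen), ⟨K, hKs, hKi, rfl, rfl⟩, ?_⟩
  rintro ⟨p₁, p₂⟩ ⟨K', hK's, hK'i, rfl, rfl⟩
  obtain ⟨h1, h2⟩ := K.sNum_sDen_unique' K' (hK's.trans hKs.symm) (hK'i.trans hKi.symm)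
  exact Prod.ext h1 h2

end NthRoot

/-- **[EtTh] Proposition 4.3 (i) modulo ONLY the two printed base-level inputs**, in EVERY setting: for every
`N`-th root of a fraction-pair with domain `≅ A_⊙` and every trivializing section, (`hα`) the section acts
over `A^bs` trivially through `α` ("`H_⊙` acts trivially on `A_⊙^bs`") and (`hamp`) every element of
`H_{B_N}^bs` is a transport along `Base(s'_N)` from `H_{A_N}` — abc-iut-L6-t12's `prop43_i_of'` with `Φ`
divisorial removed. [cite: MochizukiEtTh2009, Prop 4.3 (i) p.90–91] -/
theorem prop43_i_of'' (pullFrac : ∀ {A A' : S.C} (_ : A' ⟶ A), S.biratUnits A → S.biratUnits A')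
    (hα : ∀ {A B : S.C} {f : S.biratUnits A} {P : S.FractionPair f B} {N : ℕ+}
      (R : S.NthRoot f P N pullFrac) (hA : S.IsGalois R.AN) (striv : S.HA R.AN hA →* Aut R.AN),
      (∀ h : S.HA R.AN hA, S.autBase R.AN (striv h) = S.autBase R.AN (h : Aut R.AN)) →
      Nonempty (A ≅ S.Aodot) → ∀ h : S.HA R.AN hA,
        ModelFrobenioid.baseMap (striv h).hom ≫ ModelFrobenioid.baseMap R.α = ModelFrobenioid.baseMap R.α)
    (hamp : ∀ {A B : S.C} {f : S.biratUnits A} {P : S.FractionPair f B} {N : ℕ+}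
      (R : S.NthRoot f P N pullFrac) (hA : S.IsGalois R.AN) (hB : S.IsGalois R.BN),
      Nonempty (A ≅ S.Aodot) → ∀ g ∈ S.HAbs R.BN hB, ∃ h : S.HA R.AN hA,
        ModelFrobenioid.baseMap R.pair.num ≫ g.hom =
          (S.autBase R.AN (h : Aut R.AN)).hom ≫ ModelFrobenioid.baseMap R.pair.num) :
    S.Prop43_i pullFrac := by
  intro A B f P N R hA hB striv hstriv ident hident hAo
  refine ⟨R.existsUnique_sections' hA hB striv hstriv ident hident (hα R hA striv hstriv hAo), ?_⟩
  obtain ⟨K, -, -⟩ := R.exists_biKummerRoot' hA hB striv hstriv ident hident (hα R hA striv hstriv hAo)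
  exact K.isAmple_BN (hamp R hA hB hAo)

/-- **[EtTh] Proposition 4.3 (i) from the outer naturality of the Galois surjections ALONE** (Def. 4.1 (ii),
the owner-named law `GaloisSurjNatural`), for EVERY `S : BiKummerSetting X T D VD` and every transport
`pullFrac` — this seat's `prop43_i_of_galoisSurjNatural` (p428079) with its last structural hypothesis `Φ`
divisorial removed. [cite: MochizukiEtTh2009, Prop 4.3 (i) p.90–91] -/
theorem prop43_i_of_galoisSurjNatural'
    (pullFrac : ∀ {A A' : S.C} (_ : A' ⟶ A), S.biratUnits A → S.biratUnits A')
    (hS : S.GaloisSurjNatural) : S.Prop43_i pullFrac :=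
  S.prop43_i_of'' pullFrac
    (fun R hA striv hstriv hAo h => R.baseMap_striv_comp_α_of_galoisSurjNatural hS hA striv hstriv hAo h)
    (fun R hA hB _ g hg => R.exists_HA_base_comm_of_galoisSurjNatural hS hA hB g hg)

end Abstract

/-- **[EtTh] Proposition 4.3 (i) AS TYPED — the universal closure over all settings carrying the outer
naturality of Def. 4.1 (ii)** (FQ type; FACT-LIST row F-0492): for EVERY `S : BiKummerSetting X T D VD` with
`S.GaloisSurjNatural` and every `pullFrac`, `BiKummerSetting.Prop43_i S pullFrac`.
[cite: MochizukiEtTh2009, Prop 4.3 (i) p.90–91] -/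
theorem prop43_i_holds_of_galoisSurjNatural :
    ∀ {K : Type u₀} [Field K] {X : SemiGraphs.TemperedArithmeticGroup.{u₀} K} {D₀ : Type u₀}
      [Category.{v₀} D₀] {V : FrdIMonoidStub.{w}} {T : RealifiedDivisorMonoids (D₀ := D₀) V}
      {D : Type u} [Category.{v} D] {VD : FrdICatStub.{u, v, w} D} (S : BiKummerSetting X T D VD)
      (pullFrac : ∀ {A A' : S.C} (_ : A' ⟶ A), S.biratUnits A → S.biratUnits A'),
      S.GaloisSurjNatural → Literature.AnabelianGeometry.EtaleTheta.BiKummerSetting.Prop43_i S pullFrac :=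
  fun S pullFrac hS => S.prop43_i_of_galoisSurjNatural' pullFrac hS

/-! ### The settings over the genuine connected base `B^temp(Π^tp_X)⁰` — NO residual hypothesis -/

section Connected

open Literature.AnabelianGeometry.SemiGraphs Literature.AnabelianGeometry.SemiGraphs.GaloisObjects

variable (X : SemiGraphs.TemperedArithmeticGroup.{u₀} K) {D₀ : Type u₀} [Category.{v₀} D₀]
  {V : FrdIMonoidStub.{w}} {T : RealifiedDivisorMonoids (D₀ := D₀) V}
  {VD : FrdICatStub.{u₀ + 1, u₀, w} (ConnectedPart (BTemp X.Pi))}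
  (tf : TemperedFrobenioid T (ConnectedPart (BTemp X.Pi)) VD) (hZ : tf.monoidType = MonoidType.Z)
  (hP : ∀ A : (ConnectedPart (BTemp X.Pi))ᵒᵖ, IsPerfect (tf.Φ.carrier A))
  (NH : Subgroup (Field.absoluteGaloisGroup K) → tf.category → ℕ+ → Prop)

/-- **[EtTh] Prop. 4.3 (i) PROVED, NO residual hypothesis, for the canonical model setting over the connected
temperoid `B^temp(Π^tp_X)⁰` and a GENERAL [FrdI] vocabulary `VD`** (every `pullFrac`, `NH`, `A_⊙`): this
seat's `prop43_i_mkOfModelCanonical_connectedPart` (p429782) with `Φ` divisorial removed; the naturality is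
abc-iut-w4-d099's `mkOfModelCanonical_connectedPart_galoisSurjNatural`.
[cite: MochizukiEtTh2009, Prop 4.3 (i) p.90–91] -/
theorem prop43_i_mkOfModelCanonical_connectedPart' (A₀ : tf.category)
    (hA₀ : PreFrobenioid.IsFrobeniusTrivial tf.toElem A₀) (hA₀' : SemiGraphs.IsGaloisObj A₀.base.obj)
    (pullFrac : ∀ {A A' : tf.category} (_ : A' ⟶ A), tf.biratUnitsModel A → tf.biratUnitsModel A') :
    (BiKummerSetting.mkOfModelCanonical X tf hZ hP (fun A => SemiGraphs.IsGaloisObj A.obj)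
      (fun A h => ((connectedObjects (BTemp X.Pi)).fullyFaithfulι.autMulEquivOfFullyFaithful A).symm.toMonoidHom.comp
        (galoisSurjOf X.isTempered A.obj h))
      (fun A h => galoisSurjOf_connectedPart_surjective X.isTempered A h) NH A₀ hA₀ hA₀').Prop43_i
      (fun {_ _} φ x => pullFrac φ x) :=
  prop43_i_of_galoisSurjNatural' (fun {_ _} φ x => pullFrac φ x)
    (mkOfModelCanonical_connectedPart_galoisSurjNatural X tf hZ hP NH A₀ hA₀ hA₀')

/-- **[EtTh] Prop. 4.3 (i) PROVED, NO residual hypothesis, at abc-iut-L2-t4's §5 setting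
`mkOfConnectedTemperoid` over `B^temp(Π^tp_X)⁰`** (every `pullFrac`, `NH`, `A_⊙`; general `VD`) — the
setting the §5 assembly (`mkOfConnectedTemperoidQuot`, `mkOfConnectedTemperoidYdd`) is built on.
[cite: MochizukiEtTh2009, Prop 4.3 (i) p.90–91] -/
theorem prop43_i_mkOfConnectedTemperoid (A₀ : tf.category)
    (hA₀ : PreFrobenioid.IsFrobeniusTrivial tf.toElem A₀) (hA₀' : SemiGraphs.IsGaloisObj A₀.base.obj)
    (pullFrac : ∀ {A A' : (mkOfConnectedTemperoid X tf hZ hP NH A₀ hA₀ hA₀').C} (_ : A' ⟶ A),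
      (mkOfConnectedTemperoid X tf hZ hP NH A₀ hA₀ hA₀').biratUnits A →
        (mkOfConnectedTemperoid X tf hZ hP NH A₀ hA₀ hA₀').biratUnits A') :
    (mkOfConnectedTemperoid X tf hZ hP NH A₀ hA₀ hA₀').Prop43_i pullFrac :=
  prop43_i_of_galoisSurjNatural' pullFrac
    (mkOfModelCanonical_connectedPart_galoisSurjNatural X tf hZ hP NH A₀ hA₀ hA₀')

/-- **[EtTh] Prop. 4.3 (i) PROVED, NO residual hypothesis, at the §5 setting `mkOfConnectedTemperoidQuot`**
(`A_⊙ := (Π^tp_X/M, 0)` for an open normal `M ⊆ Π^tp_X`, so `H_⊙ = M`; every `pullFrac`, `NH`).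
[cite: MochizukiEtTh2009, Prop 4.3 (i) p.90–91] -/
theorem prop43_i_mkOfConnectedTemperoidQuot (M : OpenNormalSubgroup X.Pi)
    (pullFrac : ∀ {A A' : (mkOfConnectedTemperoidQuot X tf hZ hP NH M).C} (_ : A' ⟶ A),
      (mkOfConnectedTemperoidQuot X tf hZ hP NH M).biratUnits A →
        (mkOfConnectedTemperoidQuot X tf hZ hP NH M).biratUnits A') :
    (mkOfConnectedTemperoidQuot X tf hZ hP NH M).Prop43_i pullFrac :=
  prop43_i_mkOfConnectedTemperoid X tf hZ hP NH (tf.connQuotZeroObj M) (tf.isFrobeniusTrivial_connQuotZeroObj M)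
    (tf.isGaloisObj_connQuotZeroObj_base M) pullFrac

end Connected

end BiKummerSetting

end Literature.AnabelianGeometry.EtaleTheta

end
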